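import Summits.AnomalousDissipation.AnomalousDissipation.Theorems.TaylorCertificatesKolmogorovFloorResponseDefs

/-!
# DET′: the sheet determinant of a mode line (negative side of `TaylorCertificates.KolmogorovFloor`)

Crux stmt-AnomalousDissipation-15122, line `digit-frame-closure` (stub DET of the line skeleton); finite rational
arithmetic about `LineData.E`, `LineData.G` of `TaylorCertificatesKolmogorovFloorResponseDefs` (companion: `...Frame`).

`sheetDeterminant_le`. For `E_j = K + 2js + (j²−1)X2` under `0 < K < 2|s|`, `s² ≤ K·X2`, `16K ≤ X2`,
`9K² ≤ 4(K·X2 − s²)`, the sheet sum `G = Σ_{i ≤ J} (1/E_{2i+1} + 1/E_{−(2i+1)})` satisfies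
`G ≤ −(K·X2 − s²)/(4 s² X2)` for every `J`. Proof: the resonant pair `j = ±1` contributes
`2K/(K² − 4s²) ≤ −K/(2s²)`; a pair `j = ±(2i+1)`, `i ≥ 1`, has both `E_{±j} > 0` and contributes at most
`32/((16X2 − 9K)(j²−1)) = (8/(16X2 − 9K))·(1/i − 1/(i+1))`, which telescopes (induction on `J`) to at most
`8/(16X2 − 9K)`; finally `−K/(2s²) + 8/(16X2 − 9K) ≤ −(K·X2 − s²)/(4s²X2)` by the last two hypotheses.
-/

noncomputable section

set_option linter.dupNamespace false

open Finset
open scoped BigOperators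

namespace Summit.AnomalousDissipation.AnomalousDissipation.Theorems.KolmogorovFloor.Response

/-! ### The sheet determinant -/

/-- The resonant pair `j = ±1`: `1/(K + 2s) + 1/(K − 2s) ≤ −K/(2s²)` when `0 < K < 2|s|`. -/
private lemma pair_zero (κ σ : ℝ) (hκ : 0 < κ) (hκs : κ < 2 * |σ|) :
    (κ + 2 * σ)⁻¹ + (κ - 2 * σ)⁻¹ ≤ -(κ / (2 * σ ^ 2)) := by
  have hσabs : 0 < |σ| := by linarith
  have hσ : σ ≠ 0 := abs_pos.1 hσabs
  have h4 : κ ^ 2 < 4 * σ ^ 2 := by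
    nlinarith [sq_abs σ, mul_pos (sub_pos.2 hκs) (show (0 : ℝ) < 2 * |σ| + κ by linarith)]
  have hP : (κ + 2 * σ) * (κ - 2 * σ) < 0 := by nlinarith
  have hne1 : κ + 2 * σ ≠ 0 := fun h => by
    rw [h, zero_mul] at hP
    exact lt_irrefl _ hP
  have hne2 : κ - 2 * σ ≠ 0 := fun h => by
    rw [h, mul_zero] at hP
    exact lt_irrefl _ hP
  rw [inv_add_inv hne1 hne2, div_le_iff_of_neg hP]
  have e : -(κ / (2 * σ ^ 2)) * ((κ + 2 * σ) * (κ - 2 * σ)) = 2 * κ - κ ^ 3 / (2 * σ ^ 2) := by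
    field_simp
    ring
  rw [e]
  have : 0 ≤ κ ^ 3 / (2 * σ ^ 2) := by positivity
  linarith

/-- A non-resonant pair `j ≥ 3` (real form): with `D = K + (j²−1)X2`,
`1/(D + 2js) + 1/(D − 2js) ≤ 32/((16 X2 − 9K)(j² − 1))`. -/
private lemma pair_far (κ σ X j : ℝ) (hj : 3 ≤ j) (hκ : 0 < κ) (hCS : σ ^ 2 ≤ κ * X)
    (hX : 16 * κ ≤ X) :
    (κ + (j ^ 2 - 1) * X + 2 * j * σ)⁻¹ + (κ + (j ^ 2 - 1) * X - 2 * j * σ)⁻¹ ≤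
      32 / ((16 * X - 9 * κ) * (j ^ 2 - 1)) := by
  have hXpos : 0 < X := by linarith
  have hm : 8 ≤ j ^ 2 - 1 := by nlinarith
  have hmX : 0 < (j ^ 2 - 1) * X := mul_pos (by linarith) hXpos
  have hD : 0 < κ + (j ^ 2 - 1) * X := by linarith
  have hsq : (2 * j * σ) ^ 2 < (κ + (j ^ 2 - 1) * X) ^ 2 := by
    have h1 : (2 * j * σ) ^ 2 ≤ 4 * j ^ 2 * (κ * X) := by
      nlinarith [mul_le_mul_of_nonneg_left hCS (by positivity : (0 : ℝ) ≤ 4 * j ^ 2)]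
    have h2 : 4 * j ^ 2 * (κ * X) * 4 ≤ j ^ 2 * X ^ 2 := by
      nlinarith [mul_nonneg (mul_nonneg (sq_nonneg j) hXpos.le) (sub_nonneg.2 hX)]
    have h3 : j ^ 2 * X ^ 2 < 4 * ((j ^ 2 - 1) * X) ^ 2 := by
      nlinarith [mul_pos (mul_pos hXpos hXpos) (show (0 : ℝ) < 4 * (j ^ 2 - 1) ^ 2 - j ^ 2 by nlinarith)]
    have h4 : ((j ^ 2 - 1) * X) ^ 2 ≤ (κ + (j ^ 2 - 1) * X) ^ 2 :=
      pow_le_pow_left₀ hmX.le (by linarith) 2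
    linarith
  obtain ⟨hl, hr⟩ := abs_lt_of_sq_lt_sq' hsq hD.le
  have hEp : 0 < κ + (j ^ 2 - 1) * X + 2 * j * σ := by linarith
  have hEm : 0 < κ + (j ^ 2 - 1) * X - 2 * j * σ := by linarith
  have hden : 0 < (16 * X - 9 * κ) * (j ^ 2 - 1) := mul_pos (by linarith) (by linarith)
  rw [inv_add_inv hEp.ne' hEm.ne', div_le_div_iff₀ (mul_pos hEp hEm) hden]
  have k1 : 128 * j ^ 2 * σ ^ 2 ≤ 128 * j ^ 2 * (κ * X) := by
    nlinarith [mul_le_mul_of_nonneg_left hCS (by positivity : (0 : ℝ) ≤ 128 * j ^ 2)]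
  have k2 : 0 ≤ (j ^ 2 - 1) * (32 + 18 * (j ^ 2 - 1)) - 128 * j ^ 2 := by nlinarith
  have k3 : 0 ≤ κ * X * ((j ^ 2 - 1) * (32 + 18 * (j ^ 2 - 1)) - 128 * j ^ 2) :=
    mul_nonneg (mul_nonneg hκ.le hXpos.le) k2
  have k4 : 0 ≤ κ ^ 2 * (32 + 18 * (j ^ 2 - 1)) := mul_nonneg (sq_nonneg κ) (by linarith)
  nlinarith [k1, k3, k4]

/-- A non-resonant pair `j = 2i+1`, `i ≥ 1`, in telescoping form:
`1/E_{2i+1} + 1/E_{−(2i+1)} ≤ (8/(16 X2 − 9K))·(1/i − 1/(i+1))`. -/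
private lemma pair_succ (d : LineData) (i : ℕ) (hi : 1 ≤ i) (hK : (0 : ℝ) < d.K)
    (hCS : (d.s : ℝ) ^ 2 ≤ (d.K : ℝ) * d.X2) (hX : 16 * (d.K : ℝ) ≤ d.X2) :
    ((d.E (2 * (i : ℤ) + 1) : ℤ) : ℝ)⁻¹ + ((d.E (-(2 * (i : ℤ) + 1)) : ℤ) : ℝ)⁻¹ ≤
      8 / (16 * (d.X2 : ℝ) - 9 * d.K) * (1 / (i : ℝ) - 1 / ((i : ℝ) + 1)) := by
  have hi' : (1 : ℝ) ≤ i := by exact_mod_cast hi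
  have hXpos : (0 : ℝ) < d.X2 := by linarith
  have hden : (0 : ℝ) < 16 * (d.X2 : ℝ) - 9 * d.K := by linarith
  have e1 : ((d.E (2 * (i : ℤ) + 1) : ℤ) : ℝ) =
      (d.K : ℝ) + ((2 * (i : ℝ) + 1) ^ 2 - 1) * d.X2 + 2 * (2 * (i : ℝ) + 1) * d.s := by
    push_cast [LineData.E]
    ring
  have e2 : ((d.E (-(2 * (i : ℤ) + 1)) : ℤ) : ℝ) =
      (d.K : ℝ) + ((2 * (i : ℝ) + 1) ^ 2 - 1) * d.X2 - 2 * (2 * (i : ℝ) + 1) * d.s := by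
    push_cast [LineData.E]
    ring
  rw [e1, e2]
  refine (pair_far (d.K : ℝ) d.s d.X2 (2 * (i : ℝ) + 1) (by linarith) hK hCS hX).trans (le_of_eq ?_)
  have h1 : (16 * (d.X2 : ℝ) - 9 * d.K) ≠ 0 := hden.ne'
  have h2 : (i : ℝ) ≠ 0 := by positivity
  have h3 : (i : ℝ) + 1 ≠ 0 := by positivity
  have h4 : (2 * (i : ℝ) + 1) ^ 2 - 1 ≠ 0 := by
    have : (0 : ℝ) < (2 * (i : ℝ) + 1) ^ 2 - 1 := by nlinarith
    exact this.ne'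
  field_simp
  ring

/-- The final comparison `−K/(2s²) + 8/(16X2 − 9K) ≤ −(K·X2 − s²)/(4 s² X2)`. -/
private lemma final_real (κ σ X : ℝ) (hκ : 0 < κ) (hκs : κ < 2 * |σ|) (hCS : σ ^ 2 ≤ κ * X)
    (hX : 16 * κ ≤ X) (hA : 9 * κ ^ 2 ≤ 4 * (κ * X - σ ^ 2)) :
    -(κ / (2 * σ ^ 2)) + 8 / (16 * X - 9 * κ) ≤ -((κ * X - σ ^ 2) / (4 * σ ^ 2 * X)) := by
  have hσabs : 0 < |σ| := by linarith
  have hσ : σ ≠ 0 := abs_pos.1 hσabs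
  have hσ2 : 0 < σ ^ 2 := by positivity
  have hXpos : 0 < X := by linarith
  have hden : 0 < 16 * X - 9 * κ := by linarith
  have hb : 0 ≤ 16 * κ * X ^ 2 - 9 * κ ^ 2 * X - 16 * σ ^ 2 * X - 9 * κ * σ ^ 2 := by
    nlinarith [mul_le_mul_of_nonneg_right hA hXpos.le, mul_le_mul_of_nonneg_left hCS hκ.le,
      mul_nonneg (sq_nonneg κ) hXpos.le]
  rw [← neg_div, ← neg_div, div_add_div _ _ (by positivity) hden.ne',
    div_le_div_iff₀ (by positivity) (by positivity)]
  nlinarith [mul_nonneg hσ2.le hb]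

/-- **DET′ (sheet determinant).** Under lacunary non-resonance `0 < K < 2|s|`, Cauchy–Schwarz `s² ≤ K·X2`,
tallness `16K ≤ X2` and the angle condition `9K² ≤ 4(K·X2 − s²)`, the sheet sum
`G = Σ_{odd |j| ≤ 2J+1} 1/E_j` satisfies `G ≤ −(K·X2 − s²)/(4 s² X2) < 0` for every `J`. -/
theorem sheetDeterminant_le : ∀ (d : LineData) (J : ℕ), 0 < d.K → d.K < 2 * |d.s| → d.s ^ 2 ≤ d.K * d.X2 →
    16 * d.K ≤ d.X2 → 9 * d.K ^ 2 ≤ 4 * (d.K * d.X2 - d.s ^ 2) →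
    d.G J ≤ -(((d.K * d.X2 - d.s ^ 2 : ℤ) : ℝ) / (4 * ((d.s : ℝ) ^ 2) * (d.X2 : ℝ))) := by
  intro d J hK hKs hCS hX hA
  have hK' : (0 : ℝ) < d.K := by exact_mod_cast hK
  have hKs' : (d.K : ℝ) < 2 * |(d.s : ℝ)| := by exact_mod_cast hKs
  have hCS' : (d.s : ℝ) ^ 2 ≤ (d.K : ℝ) * d.X2 := by exact_mod_cast hCS
  have hX' : 16 * (d.K : ℝ) ≤ d.X2 := by exact_mod_cast hX
  have hA' : 9 * (d.K : ℝ) ^ 2 ≤ 4 * ((d.K : ℝ) * d.X2 - (d.s : ℝ) ^ 2) := by exact_mod_cast hA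
  have hXpos : (0 : ℝ) < d.X2 := by linarith
  have hden : (0 : ℝ) < 16 * (d.X2 : ℝ) - 9 * d.K := by linarith
  -- the recursion `G (n+1) = G n + (pair n+1)`, `G 0 = pair 0`
  have base : d.G 0 = ((d.E 1 : ℤ) : ℝ)⁻¹ + ((d.E (-1) : ℤ) : ℝ)⁻¹ := by
    simp [LineData.G, LineData.Gp, LineData.Gm]
  have step : ∀ n : ℕ, d.G (n + 1) = d.G n +
      (((d.E (2 * ((n + 1 : ℕ) : ℤ) + 1) : ℤ) : ℝ)⁻¹ + ((d.E (-(2 * ((n + 1 : ℕ) : ℤ) + 1)) : ℤ) : ℝ)⁻¹) := by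
    intro n
    simp only [LineData.G, LineData.Gp, LineData.Gm]
    rw [Finset.sum_range_succ _ (n + 1), Finset.sum_range_succ _ (n + 1)]
    ring
  -- the telescoped bound
  have main : ∀ n : ℕ, d.G n ≤ (((d.E 1 : ℤ) : ℝ)⁻¹ + ((d.E (-1) : ℤ) : ℝ)⁻¹) +
      8 / (16 * (d.X2 : ℝ) - 9 * d.K) * (1 - 1 / ((n : ℝ) + 1)) := by
    intro n
    induction n with
    | zero =>
      rw [base]
      simp
    | succ n ih =>
      rw [step n]
      have hp := pair_succ d (n + 1) (by omega) hK' hCS' hX'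
      have e : ((n + 1 : ℕ) : ℝ) = (n : ℝ) + 1 := by push_cast; ring
      rw [e] at hp ⊢
      linarith
  have ha0 : ((d.E 1 : ℤ) : ℝ)⁻¹ + ((d.E (-1) : ℤ) : ℝ)⁻¹ ≤ -((d.K : ℝ) / (2 * (d.s : ℝ) ^ 2)) := by
    have e1 : ((d.E 1 : ℤ) : ℝ) = d.K + 2 * d.s := by
      push_cast [LineData.E]
      ring
    have e2 : ((d.E (-1) : ℤ) : ℝ) = d.K - 2 * d.s := by
      push_cast [LineData.E]
      ring
    rw [e1, e2]
    exact pair_zero _ _ hK' hKs'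
  have hC : 8 / (16 * (d.X2 : ℝ) - 9 * d.K) * (1 - 1 / ((J : ℝ) + 1)) ≤ 8 / (16 * (d.X2 : ℝ) - 9 * d.K) := by
    have h1 : (0 : ℝ) ≤ 8 / (16 * (d.X2 : ℝ) - 9 * d.K) := by positivity
    have h2 : (0 : ℝ) ≤ 1 / ((J : ℝ) + 1) := by positivity
    nlinarith [mul_nonneg h1 h2]
  have hfin : -((d.K : ℝ) / (2 * (d.s : ℝ) ^ 2)) + 8 / (16 * (d.X2 : ℝ) - 9 * d.K) ≤
      -(((d.K * d.X2 - d.s ^ 2 : ℤ) : ℝ) / (4 * ((d.s : ℝ) ^ 2) * (d.X2 : ℝ))) := by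
    rw [show ((d.K * d.X2 - d.s ^ 2 : ℤ) : ℝ) = (d.K : ℝ) * d.X2 - (d.s : ℝ) ^ 2 by push_cast; ring]
    exact final_real _ _ _ hK' hKs' hCS' hX' hA'
  linarith [main J]

end Summit.AnomalousDissipation.AnomalousDissipation.Theorems.KolmogorovFloor.Response
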